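import Summits.QuantumFields.YangMills.Theorems.UnitScaleTiltProp7TentInterpolation
import HarnessLib

/-!
# Route `UnitScaleTilt`, crux K1 «MinimiserStabilityRegPr» (stmt-QuantumFields-19200), route-R E′ path (α′), row LEMMA-H-CURVED — FILE 2b(i):
# OFFSETS AND CENTRE LINES on the finest torus — `r_μ(x) = (x_μ − h) mod ℓ` (the offset above the lower k-centre in direction `μ`) and `x⌊μ⌋ = x − r_μ(x)e_μ`
# (the centre line), their behaviour under unit steps, `ℓ`-steps and steps in other directions (the `ZMod` bookkeeping of the Hermite fold ✓ `Prop7HermiteFold`)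

Cell `ym3-torus`, D-0154 (3c) twin-width seat `ym-routeR-w1` (gen 5); row «routeR-w1 g5: LEMMA-H-CURVED» (namer ★ym-ust-19200-p1 g14, 2026-08-28 17:33Z; «F-H2 GO» 17:48Z).
THEOREMS ONLY (0 `def`, 0 `sorry`); `--supports stmt-QuantumFields-19200`, count-neutral.  YM₃ on T³ is a ladder rung (R3), not the Clay problem; nothing here claims a stub, the
crux, d = 4 or the mass gap.

WHY.  The C¹ extension of coarse centre data used for LEMMA-H-curved (F-H1 ✓ `Prop7CentreBiharmonicDirichlet` reduces the lemma to ONE extension with small Laplacian energy)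
blends, on each run of `ℓ = L^k` fine sites between two consecutive k-centres in a direction `μ`, the two centre-line values with a C¹ profile.  Everything about that blend is
driven by two integers per site and direction: the OFFSET `r_μ(x) ∈ [0, ℓ)` of `x` above its lower centre and the CENTRE LINE `x⌊μ⌋`.  THIS FILE is their arithmetic on the
torus `Site P 0 = (ZMod |T|)^d` with `ℓ ∣ |T|` (true for `ℓ = L^k`, `|T| = 2L^{m+K}`): `r_μ(x + e_μ) = (r + 1) mod ℓ`, `r_μ(x − e_μ) = (r + ℓ − 1) mod ℓ`, invariance under
`ℓ`-steps and under steps in other directions, and the four centre-line transition rules (interior ∕ knot, forward ∕ backward).  The translate `h = (ℓ−1)∕2` puts the knots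
at the centres `embIter k y` of ✓ `Prop7TentInterpolation.val_embIter`.

WHAT IS PROVED (ns `…Theorems.Prop7HermiteOffsets`): `mod_val_add_natCast`, `mod_val_sub_one`, `offset_lt`, `offset_update_ne`, `offset_add_ell`, `offset_shift`, `offset_unshift`,
`corner_shift_of_lt`, `corner_shift_of_eq`, `corner_unshift_of_pos`, `corner_unshift_of_zero`, `corner_add_ell`, `offset_corner`.
HONEST SCOPE.  Modular arithmetic only; nothing of Bałaban's is asserted.

References: T. Bałaban, CMP 95 (1984) 17–40 [Balaban1984PropagatorsI] ((1.6) p.18, (1.18) p.20 — blocks, centres, block points).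
-/

set_option autoImplicit false

noncomputable section

open scoped BigOperators

namespace Summit.QuantumFields.YangMills.Theorems.Prop7HermiteOffsets

open Literature.MathematicalPhysics.QuantumFieldTheory.Balaban1983to89
open Finset
open Summit.QuantumFields.YangMills.Theorems.Prop7TentInterpolation (shift_eq_update)

variable {P : Params}

/-! ## §1 Offsets and centre lines: `r_μ(x) = (x_μ − h) mod ℓ`, `x⌊μ⌋ = x − r_μ(x)e_μ` -/

section Offsets

variable {N : ℕ} [NeZero N]

/-- `((a + t) mod N) mod ℓ = (a + t) mod ℓ` for `ℓ ∣ N`: offsets add modulo `ℓ`. [folklore] -/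
theorem mod_val_add_natCast {ℓ : ℕ} (hℓ : ℓ ∣ N) (a : ZMod N) (t : ℕ) : (a + (t : ZMod N)).val % ℓ = (a.val + t) % ℓ := by
  rw [ZMod.val_add, ZMod.val_natCast, Nat.mod_mod_of_dvd _ hℓ, Nat.add_mod, Nat.mod_mod_of_dvd _ hℓ, ← Nat.add_mod]

/-- `((a − 1) mod N) mod ℓ = (a + ℓ − 1) mod ℓ` for `ℓ ∣ N`, `N ≠ 0`. [folklore] -/
theorem mod_val_sub_one {ℓ : ℕ} (hℓ : ℓ ∣ N) (a : ZMod N) : (a - 1).val % ℓ = (a.val + (ℓ - 1)) % ℓ := by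
  obtain ⟨M, hM⟩ := hℓ
  have hN : 0 < N := Nat.pos_of_ne_zero (NeZero.ne N)
  have hM0 : 0 < M := by
    rcases Nat.eq_zero_or_pos M with h | h
    · rw [h, mul_zero] at hM; omega
    · exact h
  have hℓ0 : 0 < ℓ := by
    rcases Nat.eq_zero_or_pos ℓ with h | h
    · rw [h, zero_mul] at hM; omega
    · exact h
  have e : (a - 1 : ZMod N) = a + ((N - 1 : ℕ) : ZMod N) := by
    rw [Nat.cast_sub (by omega), ZMod.natCast_self, Nat.cast_one]; ring
  rw [e, mod_val_add_natCast ⟨M, hM⟩]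
  have hN' : N = ℓ * (M - 1) + ℓ := by
    rw [hM, ← Nat.mul_succ, Nat.succ_eq_add_one, Nat.sub_add_cancel hM0]
  have hsplit : a.val + (N - 1) = a.val + (ℓ - 1) + ℓ * (M - 1) := by
    generalize ℓ * (M - 1) = t at hN' ⊢
    omega
  rw [hsplit, Nat.add_mul_mod_self_left]

variable (ℓ : ℕ) (h : ZMod (P.sitesPerDir 0))

/-- the offset is `< ℓ` (`ℓ ≥ 1`). [folklore] -/
theorem offset_lt (hℓ : 0 < ℓ) (x : Site P 0) (μ : Fin P.d) : (x μ - h).val % ℓ < ℓ := Nat.mod_lt _ hℓ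

/-- a translation in another coordinate does not change the offset. [folklore] -/
theorem offset_update_ne {μ ν : Fin P.d} (hνμ : ν ≠ μ) (x : Site P 0) (a : ZMod (P.sitesPerDir 0)) :
    ((Function.update x ν a) μ - h).val % ℓ = (x μ - h).val % ℓ := by
  rw [Function.update_of_ne hνμ.symm]

/-- a translation by `ℓ` in the same coordinate does not change the offset. [folklore] -/
theorem offset_add_ell (hℓN : ℓ ∣ P.sitesPerDir 0) (x : Site P 0) (μ : Fin P.d) :
    ((Function.update x μ (x μ + ((ℓ : ℕ) : ZMod (P.sitesPerDir 0)))) μ - h).val % ℓ = (x μ - h).val % ℓ := by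
  rw [Function.update_self, show x μ + ((ℓ : ℕ) : ZMod (P.sitesPerDir 0)) - h = (x μ - h) + ((ℓ : ℕ) : ZMod (P.sitesPerDir 0)) by ring,
    mod_val_add_natCast hℓN, Nat.add_mod_right]

/-- the offset of the forward neighbour: `r_μ(x + e_μ) = (r_μ(x) + 1) mod ℓ`. [folklore] -/
theorem offset_shift (hℓN : ℓ ∣ P.sitesPerDir 0) (x : Site P 0) (μ : Fin P.d) :
    ((x.shift μ) μ - h).val % ℓ = ((x μ - h).val % ℓ + 1) % ℓ := by
  rw [shift_eq_update, Function.update_self, show x μ + 1 - h = (x μ - h) + ((1 : ℕ) : ZMod (P.sitesPerDir 0)) by push_cast; ring,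
    mod_val_add_natCast hℓN, Nat.mod_add_mod]

/-- the offset of the backward neighbour: `r_μ(x − e_μ) = (r_μ(x) + ℓ − 1) mod ℓ`. [folklore] -/
theorem offset_unshift (hℓN : ℓ ∣ P.sitesPerDir 0) (x : Site P 0) (μ : Fin P.d) :
    ((x.unshift μ) μ - h).val % ℓ = ((x μ - h).val % ℓ + (ℓ - 1)) % ℓ := by
  have e : (x.unshift μ) μ - h = (x μ - h) - 1 := by
    show Function.update x μ (x μ - 1) μ - h = _
    rw [Function.update_self]; ring
  rw [e, mod_val_sub_one hℓN, Nat.mod_add_mod]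

/-- the centre line of the forward neighbour, interior case: `r + 1 < ℓ ⇒ (x + e_μ)⌊μ⌋ = x⌊μ⌋`. [folklore] -/
theorem corner_shift_of_lt (hℓN : ℓ ∣ P.sitesPerDir 0) (x : Site P 0) (μ : Fin P.d) (hr : (x μ - h).val % ℓ + 1 < ℓ) :
    Function.update (x.shift μ) μ ((x.shift μ) μ - ((((x.shift μ) μ - h).val % ℓ : ℕ) : ZMod (P.sitesPerDir 0)))
      = Function.update x μ (x μ - (((x μ - h).val % ℓ : ℕ) : ZMod (P.sitesPerDir 0))) := by
  rw [offset_shift ℓ h hℓN, Nat.mod_eq_of_lt hr, shift_eq_update]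
  funext ν
  by_cases hν : ν = μ
  · subst hν; simp only [Function.update_self]; push_cast; ring
  · simp only [Function.update_of_ne hν]

/-- the centre line of the forward neighbour, knot case: `r + 1 = ℓ ⇒ (x + e_μ)⌊μ⌋ = x⌊μ⌋ + ℓe_μ`. [folklore] -/
theorem corner_shift_of_eq (hℓN : ℓ ∣ P.sitesPerDir 0) (x : Site P 0) (μ : Fin P.d) (hr : (x μ - h).val % ℓ + 1 = ℓ) :
    Function.update (x.shift μ) μ ((x.shift μ) μ - ((((x.shift μ) μ - h).val % ℓ : ℕ) : ZMod (P.sitesPerDir 0)))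
      = Function.update x μ (x μ - (((x μ - h).val % ℓ : ℕ) : ZMod (P.sitesPerDir 0)) + ((ℓ : ℕ) : ZMod (P.sitesPerDir 0))) := by
  rw [offset_shift ℓ h hℓN, hr, Nat.mod_self, shift_eq_update]
  have hℓr : ((ℓ : ℕ) : ZMod (P.sitesPerDir 0)) = (((x μ - h).val % ℓ : ℕ) : ZMod (P.sitesPerDir 0)) + 1 := by
    have e := congrArg (fun n : ℕ => (n : ZMod (P.sitesPerDir 0))) hr.symm
    simp only [Nat.cast_add, Nat.cast_one] at e
    exact e
  funext ν
  by_cases hν : ν = μ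
  · subst hν; simp only [Function.update_self]; rw [hℓr]; push_cast; ring
  · simp only [Function.update_of_ne hν]

/-- the centre line of the backward neighbour, interior case: `r ≥ 1 ⇒ (x − e_μ)⌊μ⌋ = x⌊μ⌋`. [folklore] -/
theorem corner_unshift_of_pos (hℓN : ℓ ∣ P.sitesPerDir 0) (hℓ : 0 < ℓ) (x : Site P 0) (μ : Fin P.d) (hr : 1 ≤ (x μ - h).val % ℓ) :
    Function.update (x.unshift μ) μ ((x.unshift μ) μ - ((((x.unshift μ) μ - h).val % ℓ : ℕ) : ZMod (P.sitesPerDir 0)))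
      = Function.update x μ (x μ - (((x μ - h).val % ℓ : ℕ) : ZMod (P.sitesPerDir 0))) := by
  have hℓ0 : 0 < ℓ := hℓ
  set r : ℕ := (x μ - h).val % ℓ with hrdef
  have hlt : r < ℓ := Nat.mod_lt _ hℓ0
  have hsum : r + (ℓ - 1) = (r - 1) + ℓ := by omega
  have e1 : (r + (ℓ - 1)) % ℓ = r - 1 := by
    rw [hsum, Nat.add_mod_right, Nat.mod_eq_of_lt (by omega)]
  rw [offset_unshift ℓ h hℓN, e1]
  funext ν
  by_cases hν : ν = μ
  · subst hν
    simp only [Function.update_self]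
    show Function.update x ν (x ν - 1) ν - _ = _
    rw [Function.update_self, Nat.cast_sub hr, Nat.cast_one]; ring
  · simp only [Function.update_of_ne hν]
    show Function.update x μ (x μ - 1) ν = x ν
    rw [Function.update_of_ne hν]

/-- the centre line of the backward neighbour, knot case: `r = 0 ⇒ (x − e_μ)⌊μ⌋ = x⌊μ⌋ − ℓe_μ` (`ℓ ≥ 1`). [folklore] -/
theorem corner_unshift_of_zero (hℓN : ℓ ∣ P.sitesPerDir 0) (hℓ : 0 < ℓ) (x : Site P 0) (μ : Fin P.d) (hr : (x μ - h).val % ℓ = 0) :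
    Function.update (x.unshift μ) μ ((x.unshift μ) μ - ((((x.unshift μ) μ - h).val % ℓ : ℕ) : ZMod (P.sitesPerDir 0)))
      = Function.update x μ (x μ - (((x μ - h).val % ℓ : ℕ) : ZMod (P.sitesPerDir 0)) - ((ℓ : ℕ) : ZMod (P.sitesPerDir 0))) := by
  have e1 : ((x μ - h).val % ℓ + (ℓ - 1)) % ℓ = ℓ - 1 := by
    rw [hr, zero_add, Nat.mod_eq_of_lt (by omega)]
  rw [offset_unshift ℓ h hℓN, e1, hr]
  funext ν
  by_cases hν : ν = μ
  · subst hν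
    simp only [Function.update_self]
    show Function.update x ν (x ν - 1) ν - _ = _
    rw [Function.update_self, Nat.cast_sub (by omega : 1 ≤ ℓ), Nat.cast_one, Nat.cast_zero]; ring
  · simp only [Function.update_of_ne hν]
    show Function.update x μ (x μ - 1) ν = x ν
    rw [Function.update_of_ne hν]

/-- the centre line of the `ℓ`-translate: `(x + ℓe_μ)⌊μ⌋ = x⌊μ⌋ + ℓe_μ`. [folklore] -/
theorem corner_add_ell (hℓN : ℓ ∣ P.sitesPerDir 0) (x : Site P 0) (μ : Fin P.d) :
    Function.update (Function.update x μ (x μ + ((ℓ : ℕ) : ZMod (P.sitesPerDir 0)))) μ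
        ((Function.update x μ (x μ + ((ℓ : ℕ) : ZMod (P.sitesPerDir 0)))) μ
          - ((((Function.update x μ (x μ + ((ℓ : ℕ) : ZMod (P.sitesPerDir 0)))) μ - h).val % ℓ : ℕ) : ZMod (P.sitesPerDir 0)))
      = Function.update x μ (x μ - (((x μ - h).val % ℓ : ℕ) : ZMod (P.sitesPerDir 0)) + ((ℓ : ℕ) : ZMod (P.sitesPerDir 0))) := by
  rw [offset_add_ell ℓ h hℓN]
  funext ν
  by_cases hν : ν = μ
  · subst hν; simp only [Function.update_self]; ring
  · simp only [Function.update_of_ne hν]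

/-- the offset of a point on a centre line vanishes: `r_μ(x⌊μ⌋) = 0`. [folklore] -/
theorem offset_corner (hℓN : ℓ ∣ P.sitesPerDir 0) (x : Site P 0) (μ : Fin P.d) :
    ((Function.update x μ (x μ - (((x μ - h).val % ℓ : ℕ) : ZMod (P.sitesPerDir 0)))) μ - h).val % ℓ = 0 := by
  rw [Function.update_self]
  set r : ℕ := (x μ - h).val % ℓ with hr
  have hrle : r ≤ (x μ - h).val := Nat.mod_le _ _
  have e : x μ - (r : ZMod (P.sitesPerDir 0)) - h = ((((x μ - h).val - r : ℕ)) : ZMod (P.sitesPerDir 0)) := by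
    rw [Nat.cast_sub hrle, ZMod.natCast_zmod_val]; ring
  rw [e, ZMod.val_natCast, Nat.mod_mod_of_dvd _ hℓN, hr]
  exact Nat.sub_mod_eq_zero_of_mod_eq (Nat.mod_mod _ _).symm

end Offsets


end Summit.QuantumFields.YangMills.Theorems.Prop7HermiteOffsets

end
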